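import Summits.MatrixMultiplication.MatrixMultiplication.Theorems.SoloInformedCwTwoDoor
import Summits.MatrixMultiplication.MatrixMultiplication.Theorems.SoloInformedCwTwoCubeKoszulFourRank
import Literature.Barriers.MatrixMultiplication.UniversalMethodBarrierAsymptoticRank
import Literature.Computability.AlgebraicComplexity.AsymptoticRankBorderRank
import Literature.Computability.AlgebraicComplexity.KoszulFlatteningKronecker
import Literature.Computability.AlgebraicComplexity.BorderRankRestriction

/-!
# Door D1 in finitary form: border-rank certificates for Kronecker powers of `T_{cw,2}`

Solo seat `solo-MatrixMultiplication-informed` (gen 3). The door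
`R̃(T_{cw,2}) ≤ 3 → ω = 2` (`matrixMultiplication_of_asymptoticRank_cwTensor_two_le_three`) is
restated over the computable quantities `bR(T_{cw,2}^{⊠n})`, `n ≥ 1` — the exact shape of what a
constructive proof of D1 has to exhibit:

* `asymptoticRank_pow_le_kroneckerPow` — **`R̃(t)^n ≤ R̃(t^{⊗n})`** (general `t`, `n ≥ 1`; with the
  tree's `R̃(t^{⊗n}) ≤ R̃(t)^n` this is Fekete's equality), hence
  `asymptoticRank_pow_le_algBorderRank_kroneckerPow` — **`R̃(t)^n ≤ bR(t^{⊗n})`** and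
  `asymptoticRank_le_of_algBorderRank_kroneckerPow_le` — a level-`n` certificate `bR(t^{⊗n}) ≤ r^n`
  gives `R̃(t) ≤ r`;
* `exists_tensorRank_kroneckerPow_lt_of_asymptoticRank_lt` — conversely `R̃(t) < r` is witnessed by
  some power with `R(t^{⊗n}) < r^n`;
* `asymptoticRank_cwTensor_two_le_three_iff_certificates` —
  **`R̃(T_{cw,2}) ≤ 3 ↔ ∀ ε > 0, ∃ n ≥ 1, bR(T_{cw,2}^{⊠n}) ≤ (3 + ε)^n`** (and the same with
  `R(T_{cw,2}^{⊠n}) < (3 + ε)^n`), and `matrixMultiplication_of_cwTwo_borderRank_certificates` —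
  such a family of certificates proves `ω = 2`;
* `three_pow_lt_algBorderRank_kroneckerPow_cwTensor_two` — **`3^n < bR(T_{cw,2}^{⊠n})` for every
  `n ≥ 1`** (`n = 1, 2` from the seat's certified `bR(T_{cw,2}^{⊠3}) ≥ 48` by submultiplicativity,
  `n ≥ 3` from the certified Koszul bound `3315 · 3^{n-3} ≤ 70 · bR(T_{cw,2}^{⊠n})`): no certificate
  with `ε = 0` exists at any level, so the certificates demanded by D1 necessarily have `ε = ε(n) → 0`
  along a sequence `n → ∞` — D1 is a genuinely asymptotic statement
  (`not_exists_exact_cwTwo_certificate`).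

[cite: ChristandlVranaZuiddam2023, §1.1]
[cite: BurgisserClausenShokrollahi1997, Lemma (15.27), Ex. 15.24 (7)]
[cite: ConnerGesmundoLandsbergVentura2022, §1.1, Thm. 1.2 (iii)]
[cite: CoppersmithWinograd1990, §11]
-/

namespace Summit.MatrixMultiplication.MatrixMultiplication.Theorems

open Literature.Computability.AlgebraicComplexity
open Literature.Barriers.MatrixMultiplication (asymptoticRank_le_rpow tensorRank_kroneckerPow_mul)

noncomputable section

/-! ## `R̃(t)^n ≤ bR(t^{⊗n})`: every level gives a certificate -/

section Generic

variable {K : Type*} [Field K] {ι κ μ : Type*} [Fintype ι] [Fintype κ] [Fintype μ]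
  [DecidableEq ι] [DecidableEq κ] [DecidableEq μ]

omit [DecidableEq ι] [DecidableEq κ] [DecidableEq μ] in
/-- **`R̃(t)^n ≤ R̃(t^{⊗n})`** for `n ≥ 1`: `R̃(t) ≤ R(t^{⊗n(M+1)})^{1/(n(M+1))} =
(R((t^{⊗n})^{⊗(M+1)})^{1/(M+1)})^{1/n}` for every `M`. [cite: ChristandlVranaZuiddam2023, §1.1] -/
theorem asymptoticRank_pow_le_kroneckerPow (t : ι → κ → μ → K) {n : ℕ} (hn : 0 < n) :
    asymptoticRank t ^ n ≤ asymptoticRank (kroneckerPow t n) := by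
  have h0 : 0 ≤ asymptoticRank t := asymptoticRank_nonneg t
  have hn' : (n : ℝ) ≠ 0 := by exact_mod_cast hn.ne'
  show asymptoticRank t ^ n ≤
    (⨅ M : ℕ, ((tensorRank (kroneckerPow (kroneckerPow t n) (M + 1)) : ℝ) ^ ((M : ℝ) + 1)⁻¹))
  refine le_ciInf fun M => ?_
  have hpos : 0 < (M + 1) * n := Nat.mul_pos (Nat.succ_pos M) hn
  have h1 := asymptoticRank_le_rpow t hpos
  rw [tensorRank_kroneckerPow_mul t (M + 1) n] at h1
  have hexp : ((((M + 1) * n : ℕ) : ℝ))⁻¹ * (n : ℝ) = ((M : ℝ) + 1)⁻¹ := by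
    push_cast
    field_simp
  calc asymptoticRank t ^ n
      ≤ ((tensorRank (kroneckerPow (kroneckerPow t n) (M + 1)) : ℝ) ^
          ((((M + 1) * n : ℕ) : ℝ))⁻¹) ^ n := pow_le_pow_left₀ h0 h1 n
    _ = (tensorRank (kroneckerPow (kroneckerPow t n) (M + 1)) : ℝ) ^ ((M : ℝ) + 1)⁻¹ := by
        rw [← Real.rpow_natCast, ← Real.rpow_mul (Nat.cast_nonneg _), hexp]

/-- **`R̃(t)^n ≤ bR(t^{⊗n})`** (`n ≥ 1`): with `R̃ ≤ bR` (BCS Lemma (15.27)) applied to the power.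
[cite: BurgisserClausenShokrollahi1997, Lemma (15.27)] -/
theorem asymptoticRank_pow_le_algBorderRank_kroneckerPow (t : ι → κ → μ → K) {n : ℕ}
    (hn : 0 < n) : asymptoticRank t ^ n ≤ (algBorderRank (kroneckerPow t n) : ℝ) :=
  (asymptoticRank_pow_le_kroneckerPow t hn).trans (asymptoticRank_le_algBorderRank _)

/-- A **level-`n` border-rank certificate**: `bR(t^{⊗n}) ≤ r^n` gives `R̃(t) ≤ r`.
[cite: BurgisserClausenShokrollahi1997, Lemma (15.27)] -/
theorem asymptoticRank_le_of_algBorderRank_kroneckerPow_le (t : ι → κ → μ → K) {n : ℕ}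
    (hn : 0 < n) {r : ℝ} (hr : 0 ≤ r) (h : (algBorderRank (kroneckerPow t n) : ℝ) ≤ r ^ n) :
    asymptoticRank t ≤ r :=
  (pow_le_pow_iff_left₀ (asymptoticRank_nonneg t) hr hn.ne').1
    ((asymptoticRank_pow_le_algBorderRank_kroneckerPow t hn).trans h)

omit [DecidableEq ι] [DecidableEq κ] [DecidableEq μ] in
/-- Conversely, **`R̃(t) < r` is witnessed at a finite level**: some `n ≥ 1` has `R(t^{⊗n}) < r^n`
(definition of `R̃` as an infimum). [cite: ChristandlVranaZuiddam2023, §1.1] -/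
theorem exists_tensorRank_kroneckerPow_lt_of_asymptoticRank_lt (t : ι → κ → μ → K) {r : ℝ}
    (h : asymptoticRank t < r) :
    ∃ n : ℕ, 0 < n ∧ (tensorRank (kroneckerPow t n) : ℝ) < r ^ n := by
  have h' : (⨅ N : ℕ, ((tensorRank (kroneckerPow t (N + 1)) : ℝ) ^ ((N : ℝ) + 1)⁻¹)) < r := h
  obtain ⟨N, hN⟩ := exists_lt_of_ciInf_lt h'
  refine ⟨N + 1, Nat.succ_pos N, ?_⟩
  have hx : 0 ≤ (tensorRank (kroneckerPow t (N + 1)) : ℝ) := Nat.cast_nonneg _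
  have hroot : 0 ≤ ((tensorRank (kroneckerPow t (N + 1)) : ℝ) ^ ((N : ℝ) + 1)⁻¹) := by
    positivity
  calc (tensorRank (kroneckerPow t (N + 1)) : ℝ)
      = ((tensorRank (kroneckerPow t (N + 1)) : ℝ) ^ ((N : ℝ) + 1)⁻¹) ^ (N + 1) := by
        rw [show ((N : ℝ) + 1) = ((N + 1 : ℕ) : ℝ) by push_cast; ring]
        exact (Real.rpow_inv_natCast_pow hx (Nat.succ_ne_zero N)).symm
    _ < r ^ (N + 1) := pow_lt_pow_left₀ hN hroot (Nat.succ_ne_zero N)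

/-- `bR(t^{⊗(a+b)}) ≤ bR(t^{⊗a}) · bR(t^{⊗b})`. [cite: ConnerGesmundoLandsbergVentura2022, §1.1] -/
theorem algBorderRank_kroneckerPow_add_le (t : ι → κ → μ → K) (a b : ℕ) :
    algBorderRank (kroneckerPow t (a + b)) ≤
      algBorderRank (kroneckerPow t a) * algBorderRank (kroneckerPow t b) :=
  (algBorderRank_kroneckerPow_add t a b).trans_le (algBorderRank_kroneckerTensor_le _ _)

end Generic

/-! ## The door as a family of certificates -/

/-- **D1, finitary form.** If for every `ε > 0` some Kronecker power of the small
Coppersmith–Winograd tensor has border rank `bR(T_{cw,2}^{⊠n}) ≤ (3 + ε)^n`, then `ω = 2`.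
[cite: CoppersmithWinograd1990, §11] [cite: BurgisserClausenShokrollahi1997, Ex. 15.24 (7)] -/
theorem matrixMultiplication_of_cwTwo_borderRank_certificates
    (h : ∀ ε : ℝ, 0 < ε → ∃ n : ℕ, 0 < n ∧
      (algBorderRank (kroneckerPow (cwTensor ℂ 2) n) : ℝ) ≤ (3 + ε) ^ n) :
    _root_.MatrixMultiplication := by
  refine matrixMultiplication_of_asymptoticRank_cwTensor_two_le_three
    (le_of_forall_pos_le_add fun ε hε => ?_)
  obtain ⟨n, hn, hle⟩ := h ε hε
  exact asymptoticRank_le_of_algBorderRank_kroneckerPow_le _ hn (by linarith) hle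

/-- **`R̃(T_{cw,2}) ≤ 3 ↔` border-rank certificates of quality `(3 + ε)^n` exist for every `ε > 0`.**
[cite: ChristandlVranaZuiddam2023, §1.1] [cite: BurgisserClausenShokrollahi1997, Lemma (15.27)] -/
theorem asymptoticRank_cwTensor_two_le_three_iff_certificates :
    asymptoticRank (cwTensor ℂ 2) ≤ 3 ↔
      ∀ ε : ℝ, 0 < ε → ∃ n : ℕ, 0 < n ∧
        (algBorderRank (kroneckerPow (cwTensor ℂ 2) n) : ℝ) ≤ (3 + ε) ^ n := by
  constructor
  · intro h ε hε
    obtain ⟨n, hn, hlt⟩ := exists_tensorRank_kroneckerPow_lt_of_asymptoticRank_lt (cwTensor ℂ 2)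
      (show asymptoticRank (cwTensor ℂ 2) < 3 + ε by linarith)
    refine ⟨n, hn, le_trans ?_ hlt.le⟩
    exact_mod_cast algBorderRank_le_tensorRank _
  · intro h
    refine le_of_forall_pos_le_add fun ε hε => ?_
    obtain ⟨n, hn, hle⟩ := h ε hε
    exact asymptoticRank_le_of_algBorderRank_kroneckerPow_le _ hn (by linarith) hle

/-- The same with **rank certificates** `R(T_{cw,2}^{⊠n}) < (3 + ε)^n`.
[cite: ChristandlVranaZuiddam2023, §1.1] -/
theorem asymptoticRank_cwTensor_two_le_three_iff_rank_certificates :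
    asymptoticRank (cwTensor ℂ 2) ≤ 3 ↔
      ∀ ε : ℝ, 0 < ε → ∃ n : ℕ, 0 < n ∧
        (tensorRank (kroneckerPow (cwTensor ℂ 2) n) : ℝ) < (3 + ε) ^ n := by
  constructor
  · intro h ε hε
    exact exists_tensorRank_kroneckerPow_lt_of_asymptoticRank_lt (cwTensor ℂ 2) (by linarith)
  · intro h
    refine asymptoticRank_cwTensor_two_le_three_iff_certificates.2 fun ε hε => ?_
    obtain ⟨n, hn, hlt⟩ := h ε hε
    refine ⟨n, hn, le_trans ?_ hlt.le⟩
    exact_mod_cast algBorderRank_le_tensorRank _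

/-- **D1 ⟺ certificates**, door form: a family of certificates as above proves `ω = 2`, and is
exactly what `R̃(T_{cw,2}) ≤ 3` means. [cite: CoppersmithWinograd1990, §11] -/
theorem matrixMultiplication_of_cwTwo_rank_certificates
    (h : ∀ ε : ℝ, 0 < ε → ∃ n : ℕ, 0 < n ∧
      (tensorRank (kroneckerPow (cwTensor ℂ 2) n) : ℝ) < (3 + ε) ^ n) :
    _root_.MatrixMultiplication :=
  matrixMultiplication_of_asymptoticRank_cwTensor_two_le_three
    (asymptoticRank_cwTensor_two_le_three_iff_rank_certificates.2 h)

/-! ## No exact certificate: `3^n < bR(T_{cw,2}^{⊠n})` at every level -/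

/-- **`3^n < bR(T_{cw,2}^{⊠n})` for every `n ≥ 1`.** `n ≥ 3`: the seat's kernel-certified Koszul
bound `3315 · 3^{n-3} ≤ 70 · bR(T_{cw,2}^{⊠n})` (`bR ≥ 1.754 · 3^n`); `n = 1, 2`: from
`bR(T_{cw,2}^{⊠3}) ≥ 48` and submultiplicativity (`48 ≤ bR(T^{⊠1})^3`, `48 ≤ 4 · bR(T^{⊠2})`).
[cite: ConnerGesmundoLandsbergVentura2022, Thm. 1.2 (iii), §1.1] -/
theorem three_pow_lt_algBorderRank_kroneckerPow_cwTensor_two {n : ℕ} (hn : 1 ≤ n) :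
    3 ^ n < algBorderRank (kroneckerPow (cwTensor ℂ 2) n) := by
  have h48 : 48 ≤ algBorderRank (kroneckerPow (cwTensor ℂ 2) 3) :=
    le_algBorderRank_kroneckerPow_cwTensor_two_three_p4
  rcases Nat.lt_or_ge n 3 with hlt | hge
  · -- `bR(T^{⊠1}) ≤ bR(T)^1 ≤ 4`
    have h1 : algBorderRank (kroneckerPow (cwTensor ℂ 2) 1) ≤ 4 := by
      have h := algBorderRank_kroneckerPow_le (cwTensor ℂ 2) 1
      have h4 : algBorderRank (cwTensor ℂ 2) ≤ 2 + 2 := algBorderRank_cwTensor_le ℂ 2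
      rw [pow_one] at h
      omega
    have h12 : algBorderRank (kroneckerPow (cwTensor ℂ 2) (1 + 1)) ≤
        algBorderRank (kroneckerPow (cwTensor ℂ 2) 1) *
          algBorderRank (kroneckerPow (cwTensor ℂ 2) 1) :=
      algBorderRank_kroneckerPow_add_le _ 1 1
    have h21 : algBorderRank (kroneckerPow (cwTensor ℂ 2) (2 + 1)) ≤
        algBorderRank (kroneckerPow (cwTensor ℂ 2) 2) *
          algBorderRank (kroneckerPow (cwTensor ℂ 2) 1) :=
      algBorderRank_kroneckerPow_add_le _ 2 1
    interval_cases n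
    · -- `n = 1`: `48 ≤ x · x · x` forces `x ≥ 4`
      set x := algBorderRank (kroneckerPow (cwTensor ℂ 2) 1) with hx
      have h2 : algBorderRank (kroneckerPow (cwTensor ℂ 2) 2) ≤ x * x := h12
      have h3 : 48 ≤ x * x * x := h48.trans (h21.trans (Nat.mul_le_mul_right _ h2))
      by_contra hcon
      have hx3 : x ≤ 3 := by simpa using not_lt.mp hcon
      have : x * x * x ≤ 3 * 3 * 3 :=
        Nat.mul_le_mul (Nat.mul_le_mul hx3 hx3) hx3
      omega
    · -- `n = 2`: `48 ≤ y · 4` forces `y ≥ 12`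
      set y := algBorderRank (kroneckerPow (cwTensor ℂ 2) 2) with hy
      have h3 : 48 ≤ y * 4 := h48.trans (h21.trans (Nat.mul_le_mul_left _ h1))
      omega
  · have h := CubeP4.le_algBorderRank_kroneckerPow_cwTensor_two_p4 n hge
    obtain ⟨M, rfl⟩ : ∃ M, n = M + 3 := ⟨n - 3, by omega⟩
    rw [Nat.add_sub_cancel] at h
    have hp : 0 < 3 ^ M := by positivity
    rw [pow_add]
    set t := 3 ^ M
    norm_num
    omega

/-- Real-valued form: `(3 : ℝ)^n < bR(T_{cw,2}^{⊠n})` for `n ≥ 1`.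
[cite: ConnerGesmundoLandsbergVentura2022, Thm. 1.2 (iii)] -/
theorem three_pow_lt_algBorderRank_kroneckerPow_cwTensor_two_real {n : ℕ} (hn : 1 ≤ n) :
    (3 : ℝ) ^ n < (algBorderRank (kroneckerPow (cwTensor ℂ 2) n) : ℝ) := by
  exact_mod_cast three_pow_lt_algBorderRank_kroneckerPow_cwTensor_two hn

/-- **No exact certificate.** There is no level `n ≥ 1` with `bR(T_{cw,2}^{⊠n}) ≤ 3^n`: the
certificates `bR(T_{cw,2}^{⊠n}) ≤ (3 + ε)^n` demanded by D1 must have `ε > 0` at every level, i.e.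
`ε = ε(n) → 0` only along `n → ∞`. [cite: ConnerGesmundoLandsbergVentura2022, Thm. 1.2 (iii)] -/
theorem not_exists_exact_cwTwo_certificate :
    ¬ ∃ n : ℕ, 0 < n ∧ algBorderRank (kroneckerPow (cwTensor ℂ 2) n) ≤ 3 ^ n := by
  rintro ⟨n, hn, hle⟩
  exact absurd hle (not_le.mpr (three_pow_lt_algBorderRank_kroneckerPow_cwTensor_two hn))

/-- **Summary of the finitary door.** `ω = 2` follows from any family of certificates
`bR(T_{cw,2}^{⊠n_ε}) ≤ (3 + ε)^{n_ε}` (`ε → 0`), such a family exists iff `R̃(T_{cw,2}) ≤ 3`, and no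
member of it can have `ε = 0`. [cite: CoppersmithWinograd1990, §11]
[cite: ConnerGesmundoLandsbergVentura2022, Thm. 1.2 (iii)] -/
theorem cwTwo_door_finitary :
    ((∀ ε : ℝ, 0 < ε → ∃ n : ℕ, 0 < n ∧
        (algBorderRank (kroneckerPow (cwTensor ℂ 2) n) : ℝ) ≤ (3 + ε) ^ n) →
      _root_.MatrixMultiplication) ∧
    ((∀ ε : ℝ, 0 < ε → ∃ n : ℕ, 0 < n ∧
        (algBorderRank (kroneckerPow (cwTensor ℂ 2) n) : ℝ) ≤ (3 + ε) ^ n) ↔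
      asymptoticRank (cwTensor ℂ 2) ≤ 3) ∧
    (∀ n : ℕ, 0 < n → (3 : ℝ) ^ n < (algBorderRank (kroneckerPow (cwTensor ℂ 2) n) : ℝ)) :=
  ⟨matrixMultiplication_of_cwTwo_borderRank_certificates,
    asymptoticRank_cwTensor_two_le_three_iff_certificates.symm,
    fun _ hn => three_pow_lt_algBorderRank_kroneckerPow_cwTensor_two_real hn⟩

end

end Summit.MatrixMultiplication.MatrixMultiplication.Theorems
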